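import Literature.NumberTheory.EllipticCurves.ZpExtensionGaloisTwistSharpFlatSelmerStructure
import Literature.NumberTheory.EllipticCurves.ZpExtensionGaloisTwistExponentProofs
import Literature.NumberTheory.EllipticCurves.Sprung2024.ChromaticSmallControlProofs
import Summits.BirchSwinnertonDyer.BirchSwinnertonDyer.Theorems.ByReductionTypeAtTwoMultTransportTwistedLiftUnramified
import Summits.BirchSwinnertonDyer.BirchSwinnertonDyer.Theorems.ThetaPartnerAtTwoSignedControlAtTwoTwistRestrictInjective
import Summits.BirchSwinnertonDyer.BirchSwinnertonDyer.Theorems.ThetaPartnerAtTwoSignedTransportAtTwoResidualKummer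
import Summits.BirchSwinnertonDyer.Rank1Residual.Additive.UnramifiedAwayBadPlaces
import HarnessLib

/-!
# Route `ByReductionTypeAtTwo` (rung K4), crux `SupersingularRankZeroAtTwo` (item stmt-BirchSwinnertonDyer-19097), line
# `odd_blind_package` slot 5 (CDF_glob `FlatBlindControlOfLocalAtTwo`): BRICK 1 — THE TWISTED INFLATION–RESTRICTION AT LEVEL `J`
# INTO SPRUNG'S `Sel♭(E/ℚ_∞)[γ+1][2^J]`, `u = −1` (`ψ₂`), with KERNEL `0` under `GoodSS W 2`
# (cell `bsd-2adic`, seat `t42` GEN 37; pen SUMMON 20260831T021031Z, director-bsd (738)(2))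

HONEST FRAMING: THEOREMS ONLY (no definition, no named fact, no `sorry`, no instance); Galois-cohomological plumbing over
the ♯/♭-twisted Selmer structure `WeierstrassCurve.twistedSharpFlatSelmerStructure` (Literature
`ZpExtensionGaloisTwistSharpFlatSelmerStructure`, this seat's (D)); closes nothing (CDF_glob is NOT claimed); nothing booked;
BSD is proved for no curve by any of this. bears_on: K4 (19097), `--supports stmt-BirchSwinnertonDyer-19097`.

## What is proved

§1 (any number field `K : Type`, prime `p`, unit twist `χ_u`, `κ` CYCLOTOMIC, `S₀ = ∅`). For a class `x` of the level-`K`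
Selmer group `H¹_{𝓕^L}(K, E[p^J](χ_u))` of the twisted structure with ANY family `L` of local conditions at `p` inside the
Kummer kernels (`twistedSelmerStructureOfLocal p ∅ κ J u hu L`): its restriction `c′ = twistedTorsionToH1 x ∈ H¹(K_∞, E[p^∞])`
lies in `Sel_{p^∞}(E/K_∞)` (`twistedTorsionToH1_mem_selmerInfty_of_mem_selmerGroup_ofLocal`): Kummer at `p` and `∞` by
the structure, UNRAMIFIED hence Kummer at every `v ∤ p` along the cyclotomic tower (T-42 XX
`twistedTorsionToH1_mem_unramifiedKer` + `Rank1Residual.Additive.unramKer_le_localKerOver_of_isCyclotomic`, any reduction),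
all conjugate places by `conjH1_twistedTorsionToH1_mem`. For the ♯/♭ structure at the distinguished `v ∋ p` with Sprung's
datum `(E((K_∞)_w), Ker Col^•)`, `c′ ∈ Sel^•(E/K_∞)` (`twistedTorsionToH1_mem_sharpFlatSelmerInfty_of_mem_selmerGroup`;
the •-condition by the (D) bridge). `p^J · c′ = 0`; for `u = −1`: `conj_γ c′ = −c′`, i.e. `c′ ∈ Sel^•(E/K_∞)[γ+1] =
endInvariants (conjSharpFlatSelmerInfty … γ + 1)`; and `x ↦ c′` is injective when `E(K)[p] = 0` (TP2
`TwistRestrict.twistedTorsionToH1_injective`).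

§2 (the ss line: `K = ℚ`, `p = 2`, `u = −1`, `W` good supersingular at `2`, `κ` cyclotomic with generator `γ`, `v ∋ 2`,
Sprung's local data `(a₂ = W.frobeniusTrace 2, g, c)`, colour ♭ — binders of `FlatBlindControlFiniteAtTwo` :642–650, NO
clause (L)(TR)(hz)(hsat) needed here). ★ `OddBlindTwist.exists_addMonoidHom_flatTwistedInfRes_two`: for every `J` there is an
INJECTIVE homomorphism `H¹_{𝓕♭_J}(ℚ, E[2^J](ψ₂)) →+ Sel♭(E/ℚ_∞)[γ+1]` (`endInvariants (conjSharpFlatSelmerInfty W κ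
(closureEmb ℚ_v) (W.frobeniusTrace 2) g c .flat γ + 1)`, the group CDF says is finite) lifting `twistedTorsionToH1` and
killed by `2^J`; kernel `0` from `W(ℚ)[2] = 0` (`SignedTransportAtTwo.eq_zero_of_two_nsmul_eq_zero_of_goodSS`). Hence
`#H¹_{𝓕♭_J} ≤ #Sel♭_∞[γ+1][2^J]` — BRICK 1 of HOME/ss/gen18/CDF-ATTACK-GEN18.md §6.2.

References: [Sprung2012] Def. 7.9, Def. 7.11 (p. 1503); [GreenbergLNM1716] §4 pp. 107, 122–124; [SerreGaloisCohomology1997]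
I §2.6 (b).
-/

set_option autoImplicit false
set_option linter.dupNamespace false

noncomputable section

open scoped Classical NumberField

namespace Summit.BirchSwinnertonDyer.BirchSwinnertonDyer.Theorems

namespace OddBlindTwist

open NumberField IsDedekindDomain Field WeierstrassCurve Literature.NumberTheory.EllipticCurves
  Literature.NumberTheory.EllipticCurves.IwasawaDual Literature.NumberTheory.GaloisRepresentations
  Literature.NumberTheory.GaloisCohomology ZpExtension Literature.NumberTheory.EllipticCurves.Kobayashi2003
  Literature.NumberTheory.EllipticCurves.Sprung2017 Literature.NumberTheory.EllipticCurves.Sprung2012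
  Literature.NumberTheory.EllipticCurves.Rank1Residual
open Literature.NumberTheory.GaloisRepresentations.DiscreteGaloisModule (unramifiedSubgroup SelmerStructure)

/-! ## §1 Generic: the twisted restriction of a Selmer class lands in `Sel_{p^∞}(E/K_∞)`, in `Sel^•(E/K_∞)`, in the
`[γ+1]`-part, is killed by `p^J`, and is injective -/

section Generic

variable {K : Type} [Field K] [NumberField K] (W : WeierstrassCurve K) [W.IsElliptic] (p : ℕ) [Fact p.Prime]
  (κ : ZpExtension K p) (J : ℕ) (u : ℤ) (hu : (p : ℤ) ∣ u - 1)

/-- **`c′ = twistedTorsionToH1 x ∈ Sel_{p^∞}(E/K_∞)` for `x ∈ H¹_{𝓕^L}(K, E[p^J](χ_u))`, `S₀ = ∅`, `κ` cyclotomic**, for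
ANY family `L` of local conditions at the places above `p` inside the Kummer kernels: at `v ∋ p` and at `∞` the local class
of `x` dies in `H¹((K_∞)_w, E)` (the structure; `localResOver_twistedTorsionToH1`); at `v ∤ p` the class is unramified at
level `K`, hence `c′` is unramified over `K_∞` (T-42 XX) hence Kummer (cyclotomic tower, any reduction:
`unramKer_le_localKerOver_of_isCyclotomic`); conjugate places by `conjH1_twistedTorsionToH1_mem`.
[cite: GreenbergLNM1716, §4 pp. 107, 122–124] -/
theorem twistedTorsionToH1_mem_selmerInfty_of_mem_selmerGroup_ofLocal (hκ : κ.IsCyclotomic)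
    (L : ∀ v : HeightOneSpectrum (𝓞 K),
      AddSubgroup (galoisCohomology ((W.twistedTorsionGaloisModule p κ J u hu).restrictField (v.adicCompletion K)) 1))
    (hL : ∀ v, L v ≤ (W.twistedTorsionToLocalH1 p κ J u hu (v.adicCompletion K)).ker)
    (x : galoisCohomology (W.twistedTorsionGaloisModule p κ J u hu) 1)
    (hx : x ∈ (W.twistedSelmerStructureOfLocal p ∅ κ J u hu L).selmerGroup) :
    W.twistedTorsionToH1 p κ J u hu x ∈ W.selmerInfty κ := by
  set c := W.twistedTorsionToH1 p κ J u hu x with hc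
  have hfin : ∀ v : HeightOneSpectrum (𝓞 K), c ∈ W.localKerOver p κ.kerSubgroup (v.adicCompletion K) := by
    intro v
    have hvS : v ∉ (∅ : Finset (HeightOneSpectrum (𝓞 K))) := Finset.notMem_empty v
    by_cases hpv : ((p : ℕ) : 𝓞 K) ∈ v.asIdeal
    · rw [WeierstrassCurve.mem_localKerOver_iff, hc, W.localResOver_twistedTorsionToH1 p κ J u hu]
      exact hL v (W.res_mem_of_mem_selmerGroup_ofLocal p ∅ κ J u hu L hx hvS hpv)
    · exact Summit.BirchSwinnertonDyer.Rank1Residual.Additive.unramKer_le_localKerOver_of_isCyclotomic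
        (κ := κ) (W := W) (p := p) (v := v) hκ hpv
        (MultTransportTwistedDescent.twistedTorsionToH1_mem_unramifiedKer W p κ J u hu v x
          (W.res_mem_unramifiedSubgroup_of_mem_selmerGroup_ofLocal p ∅ κ J u hu L hx hvS hpv))
  have hinf : ∀ w : InfinitePlace K, c ∈ W.localKerOver p κ.kerSubgroup w.Completion := fun w ↦ by
    rw [WeierstrassCurve.mem_localKerOver_iff, hc, W.localResOver_twistedTorsionToH1 p κ J u hu]
    exact W.twistedTorsionToLocalH1_res_eq_zero_of_mem_selmerGroup_ofLocal p ∅ κ J u hu L hx w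
  show c ∈ W.selmerGroupOver p κ.kerSubgroup
  rw [W.mem_selmerGroupOver_iff p κ.kerSubgroup]
  exact ⟨fun v σ ↦ W.conjH1_twistedTorsionToH1_mem p κ J u hu _ x (hfin v) σ,
    fun w σ ↦ W.conjH1_twistedTorsionToH1_mem p κ J u hu _ x (hinf w) σ⟩

/-- **The plain case: `H¹_𝓕(K, E[p^J](χ_u)) → Sel_{p^∞}(E/K_∞)`** for the twisted Kummer structure
`𝓕 = twistedKummerSelmerStructure p ∅ κ J u hu` (`= 𝓕^{ker}`, `twistedSelmerStructureOfLocal_ker`), `κ` cyclotomic.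
[cite: GreenbergLNM1716, §4 pp. 122–124] -/
theorem twistedTorsionToH1_mem_selmerInfty_of_mem_selmerGroup_kummer (hκ : κ.IsCyclotomic)
    (x : galoisCohomology (W.twistedTorsionGaloisModule p κ J u hu) 1)
    (hx : x ∈ (W.twistedKummerSelmerStructure p ∅ κ J u hu).selmerGroup) :
    W.twistedTorsionToH1 p κ J u hu x ∈ W.selmerInfty κ := by
  rw [← W.twistedSelmerStructureOfLocal_ker p ∅ κ J u hu] at hx
  exact twistedTorsionToH1_mem_selmerInfty_of_mem_selmerGroup_ofLocal W p κ J u hu hκ _ (fun _ ↦ le_rfl) x hx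

variable (v : HeightOneSpectrum (𝓞 K)) (ap : ℤ) (g : absoluteGaloisGroup (v.adicCompletion K))
  (c : ℕ → localPoints W (v.adicCompletion K)) (col : Chroma)

/-- **`H¹_{𝓕^•}(K, E[p^J](χ_u)) → Sel^•(E/K_∞)`**: for the ♯/♭-twisted structure at the distinguished place `v ∋ p` with
Sprung's datum `(M, 𝒦) = (E((K_∞)_w), Ker Col^•(ap, g, c))` (`S₀ = ∅`, `κ` cyclotomic), the twisted restriction of every Selmer
class lies in Sprung's `Sel^•(E/K_∞) = sharpFlatSelmerInfty W κ (closureEmb K_v) ap g c •` (Def. 7.11): `Sel_{p^∞}`-membership by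
the previous theorem (`𝓕^• ≤ 𝓕`), the •-condition by the (D) bridge `twistedTorsionToH1_mem_sharpFlatSelmerInfty`.
[cite: Sprung2012, Def. 7.9 and Def. 7.11 (p. 1503)] [cite: GreenbergLNM1716, §4 pp. 107, 124] -/
theorem twistedTorsionToH1_mem_sharpFlatSelmerInfty_of_mem_selmerGroup (hκ : κ.IsCyclotomic)
    (hpv : ((p : ℕ) : 𝓞 K) ∈ v.asIdeal) (x : galoisCohomology (W.twistedTorsionGaloisModule p κ J u hu) 1)
    (hx : x ∈ (W.twistedSharpFlatSelmerStructure p ∅ κ J u hu v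
      (localTowerPointsOfEmb κ (closureEmb (K := K) (v.adicCompletion K)) W)
      (colemanKer κ (closureEmb (K := K) (v.adicCompletion K)) W ap g c col)).selmerGroup) :
    W.twistedTorsionToH1 p κ J u hu x ∈
      sharpFlatSelmerInfty W κ (closureEmb (K := K) (v.adicCompletion K)) ap g c col := by
  refine W.twistedTorsionToH1_mem_sharpFlatSelmerInfty p κ J u hu ap g c col x ?_ ?_
  · exact twistedTorsionToH1_mem_selmerInfty_of_mem_selmerGroup_ofLocal W p κ J u hu hκ _
      (W.twistedSharpFlatLocalFamily_le_ker p κ J u hu v _ _) x hx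
  · exact W.res_mem_twistedSharpFlatLocalKummer_of_mem_selmerGroup p ∅ κ J u hu v _ _ hx (Finset.notMem_empty v) hpv

omit [NumberField K] [W.IsElliptic] in
/-- **`p^J · c′ = 0`**: the twisted restriction of a class of the `p^J`-torsion module `E[p^J](χ_u)` is killed by `p^J`
(`pow_smul_galoisCohomology_twistedTorsion_eq_zero`). [cite: SerreGaloisCohomology1997, I §2.2] -/
theorem pow_smul_twistedTorsionToH1_eq_zero (x : galoisCohomology (W.twistedTorsionGaloisModule p κ J u hu) 1) :
    p ^ J • W.twistedTorsionToH1 p κ J u hu x = 0 := by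
  rw [← map_nsmul, W.pow_smul_galoisCohomology_twistedTorsion_eq_zero p κ J hu x, map_zero]

omit [NumberField K] [W.IsElliptic] in
/-- **At `u = −1` the twisted restriction lands in the `(−1)`-eigenspace of `conj_γ`: `conj_γ c′ = −c′`** (from
`(−1) · conj_γ c′ = c′`, `zsmul_conjH1_twistedTorsionToH1`) — the `[γ+1]`-part, Greenberg's
`H¹(F_∞, A_s) = H¹(F_∞, E[p^∞]) ⊗ κ^s` for the quadratic character of the first layer. [cite: GreenbergLNM1716, §4 pp. 107, 124] -/
theorem conjH1_twistedTorsionToH1_eq_neg (hu1 : (p : ℤ) ∣ (-1 : ℤ) - 1) {γ : absoluteGaloisGroup K}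
    (hγ : κ.IsTopGenerator γ) (x : galoisCohomology (W.twistedTorsionGaloisModule p κ J (-1) hu1) 1) :
    W.conjH1 p κ.kerSubgroup γ (W.twistedTorsionToH1 p κ J (-1) hu1 x) = -W.twistedTorsionToH1 p κ J (-1) hu1 x := by
  have h := W.zsmul_conjH1_twistedTorsionToH1 p κ J (-1) hu1 hγ x
  rw [neg_one_zsmul, neg_eq_iff_eq_neg] at h
  exact h

/-- **`c′ ∈ Sel^•(E/K_∞)[γ+1] = endInvariants (conjSharpFlatSelmerInfty … γ + 1)` at `u = −1`**: for a class of
`H¹_{𝓕^•}(K, E[p^J](χ_{−1}))` (`S₀ = ∅`, `κ` cyclotomic, `v ∋ p`), the element `⟨c′, _⟩` of `Sel^•(E/K_∞)` is killed by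
`conj_γ + 1`. [cite: Sprung2012, Def. 7.11 (p. 1503)] [cite: GreenbergLNM1716, §4 pp. 107, 124] -/
theorem twistedTorsionToH1_mem_endInvariants_add_one (hκ : κ.IsCyclotomic) (hpv : ((p : ℕ) : 𝓞 K) ∈ v.asIdeal)
    (hu1 : (p : ℤ) ∣ (-1 : ℤ) - 1) {γ : absoluteGaloisGroup K} (hγ : κ.IsTopGenerator γ)
    (x : galoisCohomology (W.twistedTorsionGaloisModule p κ J (-1) hu1) 1)
    (hx : x ∈ (W.twistedSharpFlatSelmerStructure p ∅ κ J (-1) hu1 v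
      (localTowerPointsOfEmb κ (closureEmb (K := K) (v.adicCompletion K)) W)
      (colemanKer κ (closureEmb (K := K) (v.adicCompletion K)) W ap g c col)).selmerGroup) :
    (⟨W.twistedTorsionToH1 p κ J (-1) hu1 x,
        twistedTorsionToH1_mem_sharpFlatSelmerInfty_of_mem_selmerGroup W p κ J (-1) hu1 v ap g c col hκ hpv x hx⟩ :
        sharpFlatSelmerInfty W κ (closureEmb (K := K) (v.adicCompletion K)) ap g c col) ∈
      endInvariants (conjSharpFlatSelmerInfty W κ (closureEmb (K := K) (v.adicCompletion K)) ap g c col γ + 1) := by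
  rw [mem_endInvariants_iff]
  apply Subtype.ext
  change W.conjH1 p κ.kerSubgroup γ (W.twistedTorsionToH1 p κ J (-1) hu1 x) + W.twistedTorsionToH1 p κ J (-1) hu1 x = 0
  rw [conjH1_twistedTorsionToH1_eq_neg W p κ J hu1 hγ x, neg_add_cancel]

/-- **The map `H¹_{𝓕^•}(K, E[p^J](χ_{−1})) →+ Sel^•(E/K_∞)[γ+1]` as a homomorphism**: there is an additive homomorphism into
`endInvariants (conjSharpFlatSelmerInfty … γ + 1)` lifting `twistedTorsionToH1`, killed by `p^J`, and INJECTIVE as soon as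
`E(K)[p] = 0` (TP2 `TwistRestrict.twistedTorsionToH1_injective`). [cite: GreenbergLNM1716, §4 pp. 107, 122–124]
[cite: Sprung2012, Def. 7.11 (p. 1503)] -/
theorem exists_addMonoidHom_endInvariants_add_one (hκ : κ.IsCyclotomic) (hpv : ((p : ℕ) : 𝓞 K) ∈ v.asIdeal)
    (hu1 : (p : ℤ) ∣ (-1 : ℤ) - 1) {γ : absoluteGaloisGroup K} (hγ : κ.IsTopGenerator γ)
    (hK : ∀ P : W.toAffine.Point, p • P = 0 → P = 0) :
    ∃ f : (W.twistedSharpFlatSelmerStructure p ∅ κ J (-1) hu1 v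
          (localTowerPointsOfEmb κ (closureEmb (K := K) (v.adicCompletion K)) W)
          (colemanKer κ (closureEmb (K := K) (v.adicCompletion K)) W ap g c col)).selmerGroup →+
        endInvariants (conjSharpFlatSelmerInfty W κ (closureEmb (K := K) (v.adicCompletion K)) ap g c col γ + 1),
      Function.Injective f ∧
      (∀ x, (((f x : sharpFlatSelmerInfty W κ (closureEmb (K := K) (v.adicCompletion K)) ap g c col) :
          W.subgroupH1 p κ.kerSubgroup)) = W.twistedTorsionToH1 p κ J (-1) hu1 x) ∧
      ∀ x, p ^ J • f x = 0 := by
  let f : (W.twistedSharpFlatSelmerStructure p ∅ κ J (-1) hu1 v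
          (localTowerPointsOfEmb κ (closureEmb (K := K) (v.adicCompletion K)) W)
          (colemanKer κ (closureEmb (K := K) (v.adicCompletion K)) W ap g c col)).selmerGroup →+
        endInvariants (conjSharpFlatSelmerInfty W κ (closureEmb (K := K) (v.adicCompletion K)) ap g c col γ + 1) :=
    { toFun := fun x ↦ ⟨_, twistedTorsionToH1_mem_endInvariants_add_one W p κ J v ap g c col hκ hpv hu1 hγ x.1 x.2⟩
      map_zero' := by
        apply Subtype.ext; apply Subtype.ext
        change W.twistedTorsionToH1 p κ J (-1) hu1 ((0 : (W.twistedSharpFlatSelmerStructure p ∅ κ J (-1) hu1 v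
          (localTowerPointsOfEmb κ (closureEmb (K := K) (v.adicCompletion K)) W)
          (colemanKer κ (closureEmb (K := K) (v.adicCompletion K)) W ap g c col)).selmerGroup) :
            galoisCohomology (W.twistedTorsionGaloisModule p κ J (-1) hu1) 1) = 0
        rw [AddSubgroup.coe_zero, map_zero]
      map_add' := fun x y ↦ by
        apply Subtype.ext; apply Subtype.ext
        change W.twistedTorsionToH1 p κ J (-1) hu1 ((x + y : (W.twistedSharpFlatSelmerStructure p ∅ κ J (-1) hu1 v
          (localTowerPointsOfEmb κ (closureEmb (K := K) (v.adicCompletion K)) W)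
          (colemanKer κ (closureEmb (K := K) (v.adicCompletion K)) W ap g c col)).selmerGroup) :
            galoisCohomology (W.twistedTorsionGaloisModule p κ J (-1) hu1) 1) =
          W.twistedTorsionToH1 p κ J (-1) hu1 x + W.twistedTorsionToH1 p κ J (-1) hu1 y
        rw [AddSubgroup.coe_add, map_add] }
  refine ⟨f, fun x y hxy ↦ ?_, fun x ↦ rfl, fun x ↦ ?_⟩
  · have h : W.twistedTorsionToH1 p κ J (-1) hu1 x = W.twistedTorsionToH1 p κ J (-1) hu1 y :=
      congrArg (fun s : endInvariants (conjSharpFlatSelmerInfty W κ (closureEmb (K := K) (v.adicCompletion K))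
        ap g c col γ + 1) ↦ ((s : sharpFlatSelmerInfty W κ (closureEmb (K := K) (v.adicCompletion K)) ap g c col) :
          W.subgroupH1 p κ.kerSubgroup)) hxy
    exact Subtype.ext (SignedEC.TwistRestrict.twistedTorsionToH1_injective W p κ J (-1) hu1 hK h)
  · apply Subtype.ext; apply Subtype.ext
    change ((((p ^ J • f x : endInvariants (conjSharpFlatSelmerInfty W κ
        (closureEmb (K := K) (v.adicCompletion K)) ap g c col γ + 1)) : sharpFlatSelmerInfty W κ
        (closureEmb (K := K) (v.adicCompletion K)) ap g c col) : W.subgroupH1 p κ.kerSubgroup)) = 0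
    rw [AddSubgroupClass.coe_nsmul, AddSubgroupClass.coe_nsmul]
    exact pow_smul_twistedTorsionToH1_eq_zero W p κ J (-1) hu1 x

end Generic

/-! ## §2 The supersingular line at `p = 2`, `u = −1` (`ψ₂`): BRICK 1 over the binders of `FlatBlindControlFiniteAtTwo` -/

section Two

variable (W : WeierstrassCurve ℚ) [W.IsElliptic] [W.IsGloballyMinimal]

/-- `2 ∣ (−1) − 1`: the quadratic character `ψ₂ = χ_{−1}` of `Γ = Gal(ℚ_∞/ℚ)` (`γ ↦ −1`, cutting out the first layer `ℚ(√2)`)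
is an admissible unit twist at `p = 2`. [folklore] -/
theorem two_dvd_neg_one_sub_one : ((2 : ℕ) : ℤ) ∣ (-1 : ℤ) - 1 := ⟨-1, by norm_num⟩

/-- **BRICK 1 (membership): for `x ∈ H¹_{𝓕♭_J}(ℚ, E[2^J](ψ₂))` the class `c′ = twistedTorsionToH1 x` lies in Sprung's
`Sel♭(E/ℚ_∞)` (for the line's data `a₂ = W.frobeniusTrace 2`, `g`, `c`), satisfies `conj_γ c′ = −c′`, and `2^J · c′ = 0`.**
Binders: `κ` cyclotomic with topological generator `γ`, `v ∋ 2`; NO condition on `(g, c)` is needed for this brick.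
[cite: Sprung2012, Def. 7.9 and Def. 7.11 (p. 1503)] [cite: GreenbergLNM1716, §4 pp. 107, 122–124] -/
theorem flatTwistedInfRes_two {κ : ZpExtension ℚ 2} (hκ : κ.IsCyclotomic) {γ : absoluteGaloisGroup ℚ}
    (hγ : κ.IsTopGenerator γ) (v : HeightOneSpectrum (𝓞 ℚ)) (hv : (2 : 𝓞 ℚ) ∈ v.asIdeal)
    (g : absoluteGaloisGroup (v.adicCompletion ℚ)) (c : ℕ → localPoints W (v.adicCompletion ℚ)) (J : ℕ)
    (x : galoisCohomology (W.twistedTorsionGaloisModule 2 κ J (-1) two_dvd_neg_one_sub_one) 1)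
    (hx : x ∈ (W.twistedSharpFlatSelmerStructure 2 ∅ κ J (-1) two_dvd_neg_one_sub_one v
      (localTowerPointsOfEmb κ (closureEmb (K := ℚ) (v.adicCompletion ℚ)) W)
      (colemanKer κ (closureEmb (K := ℚ) (v.adicCompletion ℚ)) W (W.frobeniusTrace 2) g c .flat)).selmerGroup) :
    W.twistedTorsionToH1 2 κ J (-1) two_dvd_neg_one_sub_one x ∈
        sharpFlatSelmerInfty W κ (closureEmb (K := ℚ) (v.adicCompletion ℚ)) (W.frobeniusTrace 2) g c .flat ∧
      W.conjH1 2 κ.kerSubgroup γ (W.twistedTorsionToH1 2 κ J (-1) two_dvd_neg_one_sub_one x) =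
        -W.twistedTorsionToH1 2 κ J (-1) two_dvd_neg_one_sub_one x ∧
      2 ^ J • W.twistedTorsionToH1 2 κ J (-1) two_dvd_neg_one_sub_one x = 0 := by
  have hpv : (((2 : ℕ) : ℕ) : 𝓞 ℚ) ∈ v.asIdeal := by exact_mod_cast hv
  exact ⟨twistedTorsionToH1_mem_sharpFlatSelmerInfty_of_mem_selmerGroup W 2 κ J (-1) two_dvd_neg_one_sub_one v
      (W.frobeniusTrace 2) g c .flat hκ hpv x hx,
    conjH1_twistedTorsionToH1_eq_neg W 2 κ J two_dvd_neg_one_sub_one hγ x,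
    pow_smul_twistedTorsionToH1_eq_zero W 2 κ J (-1) two_dvd_neg_one_sub_one x⟩

/-- **BRICK 1 (kernel `0`): on the habitat `GoodSS W 2` the twisted restriction `H¹(Γ_ℚ, E[2^J](ψ₂)) → H¹(ℚ_∞, E[2^∞])`
is injective** (`W(ℚ)[2] = 0` ⇒ `W(ℚ_∞)[2^∞] = 0` for the pro-`2` group `Γ`; TP2 `twistedTorsionToH1_injective`).
[cite: GreenbergLNM1716, §1 p. 62, §4 pp. 107, 124] -/
theorem twistedTorsionToH1_injective_of_goodSS (hss : GoodSS W 2) (κ : ZpExtension ℚ 2) (J : ℕ)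
    (u : ℤ) (hu : ((2 : ℕ) : ℤ) ∣ u - 1) :
    Function.Injective (W.twistedTorsionToH1 2 κ J u hu) :=
  -- (`convert`: the `DecidableEq ℚ` instance inside the group law of `E(ℚ)` differs syntactically between the two lemmas)
  SignedEC.TwistRestrict.twistedTorsionToH1_injective W 2 κ J u hu fun P hP ↦
    SignedTransportAtTwo.eq_zero_of_two_nsmul_eq_zero_of_goodSS W hss P (by convert hP)

/-- ★ **BRICK 1 (the map).** `W/ℚ` good supersingular at `2`, `κ` the cyclotomic `ℤ₂`-extension with topological generator
`γ`, `v ∋ 2`, Sprung's local data `(a₂, g, c)` of the line, colour ♭. For every level `J` there is an INJECTIVE additive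
homomorphism from the level-`ℚ` ♭-twisted Selmer group `H¹_{𝓕♭_J}(ℚ, E[2^J](ψ₂))` (structure
`twistedSharpFlatSelmerStructure 2 ∅ κ J (−1) _ v (E(ℚ_{∞,v})) (Ker Col♭)`) INTO `Sel♭(E/ℚ_∞)[γ+1] =
endInvariants (conjSharpFlatSelmerInfty W κ (closureEmb ℚ_v) (W.frobeniusTrace 2) g c .flat γ + 1)` — the group whose
finiteness is CDF `FlatBlindControlFiniteAtTwo` — lifting `twistedTorsionToH1` and killed by `2^J` (so landing in
`Sel♭_∞[γ+1][2^J]`). The twisted inflation–restriction of HOME/ss/gen18/CDF-ATTACK-GEN18.md §6.2, forward direction.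
[cite: GreenbergLNM1716, §4 pp. 107, 122–124] [cite: Sprung2012, Def. 7.9 and Def. 7.11 (p. 1503)] -/
theorem exists_addMonoidHom_flatTwistedInfRes_two (hss : GoodSS W 2) {κ : ZpExtension ℚ 2}
    (hκ : κ.IsCyclotomic) {γ : absoluteGaloisGroup ℚ} (hγ : κ.IsTopGenerator γ) (v : HeightOneSpectrum (𝓞 ℚ))
    (hv : (2 : 𝓞 ℚ) ∈ v.asIdeal) (g : absoluteGaloisGroup (v.adicCompletion ℚ))
    (c : ℕ → localPoints W (v.adicCompletion ℚ)) (J : ℕ) :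
    ∃ f : (W.twistedSharpFlatSelmerStructure 2 ∅ κ J (-1) two_dvd_neg_one_sub_one v
          (localTowerPointsOfEmb κ (closureEmb (K := ℚ) (v.adicCompletion ℚ)) W)
          (colemanKer κ (closureEmb (K := ℚ) (v.adicCompletion ℚ)) W (W.frobeniusTrace 2) g c .flat)).selmerGroup →+
        endInvariants (conjSharpFlatSelmerInfty W κ (closureEmb (K := ℚ) (v.adicCompletion ℚ)) (W.frobeniusTrace 2)
          g c .flat γ + 1),
      Function.Injective f ∧
      (∀ x, (((f x : sharpFlatSelmerInfty W κ (closureEmb (K := ℚ) (v.adicCompletion ℚ)) (W.frobeniusTrace 2) g c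
          .flat) : W.subgroupH1 2 κ.kerSubgroup)) = W.twistedTorsionToH1 2 κ J (-1) two_dvd_neg_one_sub_one x) ∧
      ∀ x, 2 ^ J • f x = 0 := by
  have hpv : (((2 : ℕ) : ℕ) : 𝓞 ℚ) ∈ v.asIdeal := by exact_mod_cast hv
  exact exists_addMonoidHom_endInvariants_add_one W 2 κ J v (W.frobeniusTrace 2) g c .flat hκ hpv
    two_dvd_neg_one_sub_one hγ fun P hP ↦
      SignedTransportAtTwo.eq_zero_of_two_nsmul_eq_zero_of_goodSS W hss P (by convert hP)

/-- **Consequence (counting form of BRICK 1): `#H¹_{𝓕♭_J}(ℚ, E[2^J](ψ₂)) ≤ #Sel♭_∞[γ+1]` whenever the latter is finite**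
(in particular the level-`J` groups are then bounded uniformly in `J`) — the converse direction, bounding `Sel♭_∞[γ+1][2^J]` by
the level-`J` groups, is the LIFT of BRICK 3. [cite: GreenbergLNM1716, §4 pp. 122–124] -/
theorem natCard_selmerGroup_flatTwisted_le_of_finite (hss : GoodSS W 2) {κ : ZpExtension ℚ 2}
    (hκ : κ.IsCyclotomic) {γ : absoluteGaloisGroup ℚ} (hγ : κ.IsTopGenerator γ) (v : HeightOneSpectrum (𝓞 ℚ))
    (hv : (2 : 𝓞 ℚ) ∈ v.asIdeal) (g : absoluteGaloisGroup (v.adicCompletion ℚ))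
    (c : ℕ → localPoints W (v.adicCompletion ℚ)) (J : ℕ)
    (hfin : Finite (endInvariants (conjSharpFlatSelmerInfty W κ (closureEmb (K := ℚ) (v.adicCompletion ℚ))
      (W.frobeniusTrace 2) g c .flat γ + 1))) :
    Nat.card (W.twistedSharpFlatSelmerStructure 2 ∅ κ J (-1) two_dvd_neg_one_sub_one v
          (localTowerPointsOfEmb κ (closureEmb (K := ℚ) (v.adicCompletion ℚ)) W)
          (colemanKer κ (closureEmb (K := ℚ) (v.adicCompletion ℚ)) W (W.frobeniusTrace 2) g c .flat)).selmerGroup ≤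
      Nat.card (endInvariants (conjSharpFlatSelmerInfty W κ (closureEmb (K := ℚ) (v.adicCompletion ℚ))
        (W.frobeniusTrace 2) g c .flat γ + 1)) := by
  obtain ⟨f, hf, -, -⟩ := exists_addMonoidHom_flatTwistedInfRes_two W hss hκ hγ v hv g c J
  exact Nat.card_le_card_of_injective f hf

end Two

end OddBlindTwist

end Summit.BirchSwinnertonDyer.BirchSwinnertonDyer.Theorems

end
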